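import Summits.BirchSwinnertonDyer.BirchSwinnertonDyer.Theorems.ManinLocalTwoThreeThreeShiftHeisenbergDescent
import HarnessLib

/-!
# The 3-adic shift equaliser laws at EVERY level: `K₃(N) = D(N)`, `K₃⁻(N) = 0`, `K₉(N) = D(N)` for ALL `N`
# (route `ManinLocalTwoThree`, cell bsd-f2-manin; crux C3 `ManinPrimeToThreeAtNine` stmt-BirchSwinnertonDyer-22968; LEAD seat p1 gen 11)

The cell's laws E-es-96 `ThreeShiftInvariantIsDiamond`, E-es-94♯ `NineShiftInvariantIsDiamond` (now theorems, `…ThreeShiftHeisenbergDescent.lean`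
p683034) are typed with the hypothesis `9 ∣ N`.  The hypothesis is UNNECESSARY: the tree's nodes already cover every level —
prime-to-3 base (p2's `threeShiftBasePrimeToThree_holds`, Serre's amalgam), the cube steps `Γ₀(3N₀) → Γ₀(N₀)` (p3's
`cubeStepDescent_holds` / `cubeStepAntiDescent_holds`, transfer), es's THEOREM V and the Heisenberg steps (`threeShiftAntiInvariantDescentAll_holds`)
— and the shift-defect mechanism of p3's `TowerReduction` (`isThreeShiftAntiInvariant_shiftDefect`) is level-generic.  This file assembles:
* **`threeShiftInvariantIsDiamondAt_all (N) : ThreeShiftInvariantIsDiamondAt N`** — `K₃^grp(N) = D^grp(N)` for EVERY `N` (incl. `N = 0`);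
* **`threeShiftAntiInvariantTrivialAt_all (N) (hN : 0 < N) : ThreeShiftAntiInvariantTrivialAt N`** — `K₃⁻(N) = 0` for every `N ≥ 1`
  (strong induction down the 3-adic tower);
* **`nineShiftInvariantIsDiamondAt_all (N) : ∀ φ, IsAddChar φ → IsNineShiftInvariant φ → IsDiamondChar φ`** — the NINE-shift equaliser on
  `Hom(Γ₀(N), 𝔽₃)` is the diamond span at EVERY level `N` (E-es-94♯ without `9 ∣ N`): the 3-shift defect of a 9-shift-invariant character is
  an anti-invariant character of `Γ₀(3N)`, hence zero, so the character is 3-shift invariant, hence diamond.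
LEAD census (scratch, exact group cohomology over `𝔽_p` via `H¹(SL₂(ℤ), 𝔽_p[P¹(ℤ/N)])`, script HOME/p1/g11/shift_equaliser_f2.py): `K_t(N) = D(N)`
holds at every tested `(p, t, N)` — `p = 3`, `t ∈ {3, 9}`, `N ≤ 45`; `p = 2`, `t ∈ {2, 4, 8}`, `N ≤ 28`; `p = 5`, `N ∈ {1,…,25}`; `p = 7`,
`N ∈ {1, 7, 14, 49}` — suggesting the prime-generic law «the `p`-shift equaliser in `Hom(Γ₀(N), 𝔽_p)` is the diamond span, all `p`, all
`N`» (the `p = 2` twin asked for by p3 A-p3-1; filed to the planners, NOT asserted here).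
HONEST FRAMING: unconditional compositions of tree theorems (axioms standard); structure theorems about `Γ₀(N)` — C3, Manin's conjecture
and BSD are NOT proved by this. [cite: DarmonDiamondTaylor1995, Lemma 4.28 (p. 135) (shape: degeneracy maps; the laws are the cell's)]
-/

set_option autoImplicit false
set_option linter.dupNamespace false

open scoped MatrixGroups

open CongruenceSubgroup Matrix.SpecialLinearGroup
  Summit.BirchSwinnertonDyer.Rank1Residual.ManinAdditive.NineShiftEqualiser

namespace Summit.BirchSwinnertonDyer.BirchSwinnertonDyer.Theorems.ManinLocalTwoThree

open CubeStep (cubeStepDescent_holds cubeStepAntiDescent_holds)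

/-- **`K₃⁻(N) = 0` for every `N ≥ 1`**: an additive 3-shift-ANTI-invariant `𝔽₃`-character of `Γ₀(N)` vanishes.  Strong induction down the
3-adic tower: `3 ∤ N` (Serre base, p2), `3 ∥ N` (cube anti-step, p3), `9 ∣ N` (E-es-106 `threeShiftAntiInvariantDescentAll_holds` + induction).
[new: composition of the proved nodes] -/
theorem threeShiftAntiInvariantTrivialAt_all : ∀ N : ℕ, 0 < N → ThreeShiftAntiInvariantTrivialAt N := by
  intro N
  induction N using Nat.strong_induction_on with
  | _ N ih =>
    intro hN
    by_cases h3 : 3 ∣ N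
    · obtain ⟨M, rfl⟩ := h3
      have hM : 0 < M := by omega
      by_cases h3M : 3 ∣ M
      · intro ψ hadd hanti γ
        obtain ⟨w, hwa, hwi, hr⟩ := threeShiftAntiInvariantDescentAll_holds M (3 * M) h3M rfl ψ hadd hanti
        exact eq_zero_of_restrictsFrom ⟨3, by ring⟩ hr (ih M (by omega) hM w hwa hwi) γ
      · exact antiInvariantTrivialAt_three_mul threeShiftBasePrimeToThree_holds hM h3M
    · exact (threeShiftBasePrimeToThree_holds N hN h3).2

/-- **`K₃^grp(N) = D^grp(N)` for EVERY `N`**: an additive 3-shift-invariant `𝔽₃`-character of `Γ₀(N)` is a diamond class.  `N = 0`: p3's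
`nineShiftInvariantIsDiamond_zero`; `3 ∤ N`: Serre base (p2); `3 ∥ N`: cube step (p3) + base; `9 ∣ N`: E-es-96 `threeShiftInvariantIsDiamond_holds`.
[new: composition of the proved nodes] -/
theorem threeShiftInvariantIsDiamondAt_all (N : ℕ) : ThreeShiftInvariantIsDiamondAt N := by
  rcases Nat.eq_zero_or_pos N with rfl | hN
  · exact fun φ hadd h3 => nineShiftInvariantIsDiamond_zero φ hadd (isNineShiftInvariant_of_isThreeShiftInvariant φ h3)
  by_cases h3 : 3 ∣ N
  · obtain ⟨M, rfl⟩ := h3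
    have hM : 0 < M := by omega
    by_cases h3M : 3 ∣ M
    · exact fun φ hadd hinv =>
        threeShiftInvariantIsDiamond_holds (3 * M) (by obtain ⟨k, rfl⟩ := h3M; exact ⟨k, by ring⟩) φ hadd hinv
    · intro φ hadd hinv
      obtain ⟨w, hwa, hwi, hr⟩ := cubeStepDescent_holds M (3 * M) hM h3M rfl φ hadd hinv
      exact isDiamondChar_of_restrictsFrom (dvd_mul_left M 3) hr ((threeShiftBasePrimeToThree_holds M hM h3M).1 w hwa hwi)
  · exact (threeShiftBasePrimeToThree_holds N hN h3).1

/-- **The NINE-shift equaliser is the diamond span at EVERY level** (E-es-94♯ `NineShiftInvariantIsDiamond` WITHOUT the hypothesis `9 ∣ N`):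
for every `N` and every additive `φ : Γ₀(N) → 𝔽₃` invariant under the 9-shift, `φ` is a diamond class.  Proof: the 3-shift defect of `φ` on
`Γ₀(3N)` (p3's `isAddChar_shiftDefect`, `isThreeShiftAntiInvariant_shiftDefect`) is an anti-invariant character, hence `0`
(`threeShiftAntiInvariantTrivialAt_all`), so `φ` is 3-shift invariant (`isThreeShiftInvariant_of_shiftDefect_eq_zero`), hence diamond
(`threeShiftInvariantIsDiamondAt_all`). [new: composition of the proved nodes] -/
theorem nineShiftInvariantIsDiamondAt_all (N : ℕ) (φ : Gamma0 N → ZMod 3) (hadd : IsAddChar φ)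
    (h9 : IsNineShiftInvariant φ) : IsDiamondChar φ := by
  rcases Nat.eq_zero_or_pos N with rfl | hN
  · exact nineShiftInvariantIsDiamond_zero φ hadd h9
  have hψ0 := threeShiftAntiInvariantTrivialAt_all (3 * N) (by omega) _ (isAddChar_shiftDefect hadd)
    (isThreeShiftAntiInvariant_shiftDefect h9)
  exact threeShiftInvariantIsDiamondAt_all N φ hadd (isThreeShiftInvariant_of_shiftDefect_eq_zero hψ0)

/-- **`K₉(N) ⊆ K₃(N)` at every level** (E-es-97 without `9 ∣ N`). [new: composition of the proved nodes] -/
theorem isThreeShiftInvariant_of_isNineShiftInvariant_all (N : ℕ) (φ : Gamma0 N → ZMod 3) (hadd : IsAddChar φ)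
    (h9 : IsNineShiftInvariant φ) : IsThreeShiftInvariant φ :=
  isThreeShiftInvariant_of_isDiamondChar φ hadd (nineShiftInvariantIsDiamondAt_all N φ hadd h9)

/-- The level-wise parabolic form (E-es-94 at every level). [new: composition of the proved nodes] -/
theorem parabolicNineShiftInvariantIsDiamondAt_all (N : ℕ) : ParabolicNineShiftInvariantIsDiamondAt N :=
  fun φ hadd _ h9 => nineShiftInvariantIsDiamondAt_all N φ hadd h9

end Summit.BirchSwinnertonDyer.BirchSwinnertonDyer.Theorems.ManinLocalTwoThree
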